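import Summits.AtomisticToContinuum.HydrodynamicLimit.Theorems.CollisionIsometryCLTAdaptedWeightCLTTLPastDampingKernel

/-!
# Stub `stub_pastDamping` of the line `contact-source-duhamel` — helper file: INTEGRALS OF THE BLOCK
WEIGHTS OVER THE TORUS (crux `CollisionIsometryCLT.AdaptedWeightCLT`, stmt-AtomisticToContinuum-14868,
`--supports`)

The `x`-integrals of the three kinds of terms of the pathwise PAST inequality, for an admissible kernel
family (on top of `…TLPastDampingKernel.lean`: unit mass `∫ w_k = 1`, `L¹`-Lipschitz translates):
`∫ Σ_k w_k(x) a_k dx = Σ_k a_k` (`integral_sum_wgt_mul`), `∫ Σ_k e_k (Σ_i w_i(x) b_{ki} + 3 w_k(x)) dx =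
Σ_k e_k (Σ_i b_{ki} + 3)` (`integral_sum_mul_sum_wgt`), and `∫ Σ_k Σ_i |w_i(x) − w_k(x)| b_{ki} dx ≤
lipK Σ b_{ki} d(x_i(s), x_k(s))` for `b ≥ 0` (`integral_sum_abs_sub_mul_le`); the weights are
continuous, hence integrable, in `x` (continuous kernel). Also `PastSq ≥ 0` and the fast moments of a
configuration against its exponential moment, summed over the particles (`sum_fastPow_le`).
-/

namespace Summit.AtomisticToContinuum.HydrodynamicLimit.Theorems.ContactSourceDuhamel.TimeLocal
namespace PastDamping

open scoped BigOperators Topology Classical MeasureTheory ENNReal InnerProductSpace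
open Filter Set MeasureTheory
open Literature.Analysis.FluidPDE

noncomputable section

variable {σ : ℝ} {N : ℕ}

/-! ## Integrating over the torus -/

section Torus

variable (Φ : Flow σ N) {φ : ℕ → T3 → ℝ}

/-- The block weights are continuous in `x` (continuous kernel). -/
theorem continuous_wgt (hφc : Continuous (φ N)) (s : ℝ) (z : Cfg N) (i : Fin (N + 1)) :
    Continuous fun x => wgt σ N Φ φ s z x i :=
  hφc.comp (continuous_const.sub continuous_id)

/-- The block weights are integrable in `x`. -/
theorem integrable_wgt (hφc : Continuous (φ N)) (s : ℝ) (z : Cfg N) (i : Fin (N + 1)) :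
    Integrable fun x => wgt σ N Φ φ s z x i :=
  integrable_of_continuous_T3 (continuous_wgt Φ hφc s z i)

/-- The weight increments are integrable in `x`. -/
theorem integrable_abs_wgt_sub (hφc : Continuous (φ N)) (s : ℝ) (z : Cfg N) (i k : Fin (N + 1)) :
    Integrable fun x => |wgt σ N Φ φ s z x i - wgt σ N Φ φ s z x k| :=
  integrable_of_continuous_T3 ((continuous_wgt Φ hφc s z i).sub (continuous_wgt Φ hφc s z k)).abs

/-- `∫ Σ_k w_k(x) a_k dx = Σ_k a_k` for an admissible kernel family. -/
theorem integral_sum_wgt_mul {γ C : ℝ} (hadm : AdmissibleKernel γ C φ) (s : ℝ) (z : Cfg N)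
    (a : Fin (N + 1) → ℝ) : ∫ x, ∑ k, wgt σ N Φ φ s z x k * a k = ∑ k, a k := by
  have hφc : Continuous (φ N) := (hadm.1 N).continuous
  rw [integral_finsetSum _ fun k _ => (integrable_wgt Φ hφc s z k).mul_const (a k)]
  refine Finset.sum_congr rfl fun k _ => ?_
  rw [integral_mul_const, integral_wgt hadm Φ s z k, one_mul]

/-- `∫ Σ_k e_k (Σ_i w_i(x) b_{ki} + 3 w_k(x)) dx = Σ_k e_k (Σ_i b_{ki} + 3)`. -/
theorem integral_sum_mul_sum_wgt {γ C : ℝ} (hadm : AdmissibleKernel γ C φ) (s : ℝ) (z : Cfg N)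
    (e : Fin (N + 1) → ℝ) (b : Fin (N + 1) → Fin (N + 1) → ℝ) :
    ∫ x, ∑ k, e k * (∑ i, wgt σ N Φ φ s z x i * b k i + 3 * wgt σ N Φ φ s z x k) =
      ∑ k, e k * (∑ i, b k i + 3) := by
  have hφc : Continuous (φ N) := (hadm.1 N).continuous
  have hint : ∀ k, Integrable fun x => ∑ i, wgt σ N Φ φ s z x i * b k i + 3 * wgt σ N Φ φ s z x k :=
    fun k => (integrable_finsetSum _ fun i _ => (integrable_wgt Φ hφc s z i).mul_const (b k i)).add
      ((integrable_wgt Φ hφc s z k).const_mul 3)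
  rw [integral_finsetSum _ fun k _ => (hint k).const_mul (e k)]
  refine Finset.sum_congr rfl fun k _ => ?_
  rw [integral_const_mul, integral_add (integrable_finsetSum _ fun i _ =>
      (integrable_wgt Φ hφc s z i).mul_const (b k i)) ((integrable_wgt Φ hφc s z k).const_mul 3),
    integral_sum_wgt_mul Φ hadm s z (b k), integral_const_mul, integral_wgt hadm Φ s z k, mul_one]

/-- `∫ Σ_k Σ_i |w_i(x) − w_k(x)| b_{ki} dx ≤ lipK Σ_k Σ_i d(x_i(s), x_k(s)) b_{ki}` for `b ≥ 0`. -/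
theorem integral_sum_abs_sub_mul_le {γ C : ℝ} (hadm : AdmissibleKernel γ C φ)
    (hR : ((N : ℝ) + 1) ^ (-γ) < 1 / 2) (s : ℝ) (z : Cfg N) {b : Fin (N + 1) → Fin (N + 1) → ℝ}
    (hb : ∀ k i, 0 ≤ b k i) :
    ∫ x, ∑ k, ∑ i, |wgt σ N Φ φ s z x i - wgt σ N Φ φ s z x k| * b k i ≤
      lipK C γ N * ∑ k, ∑ i, b k i * Torus.euclidDist (Φ.flow s z i).1 (Φ.flow s z k).1 := by
  have hφc : Continuous (φ N) := (hadm.1 N).continuous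
  rw [integral_finsetSum _ fun k _ => integrable_finsetSum _ fun i _ =>
    (integrable_abs_wgt_sub Φ hφc s z i k).mul_const (b k i), Finset.mul_sum]
  refine Finset.sum_le_sum fun k _ => ?_
  rw [integral_finsetSum _ fun i _ => (integrable_abs_wgt_sub Φ hφc s z i k).mul_const (b k i),
    Finset.mul_sum]
  refine Finset.sum_le_sum fun i _ => ?_
  rw [integral_mul_const]
  calc (∫ x, |wgt σ N Φ φ s z x i - wgt σ N Φ φ s z x k|) * b k i
      ≤ (lipK C γ N * Torus.euclidDist (Φ.flow s z i).1 (Φ.flow s z k).1) * b k i :=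
        mul_le_mul_of_nonneg_right (integral_abs_wgt_sub_le hadm hR Φ s z i k) (hb k i)
    _ = lipK C γ N * (b k i * Torus.euclidDist (Φ.flow s z i).1 (Φ.flow s z k).1) := by ring

/-- `PastSq ≥ 0` (a sum of squares). -/
theorem pastSq_nonneg (φ : ℕ → T3 → ℝ) (s : ℝ) (z : Cfg N) (x : T3) : 0 ≤ PastSq σ N Φ φ s z x :=
  add_nonneg (Finset.sum_nonneg fun _ _ => Finset.sum_nonneg fun _ _ => sq_nonneg _)
    (Finset.sum_nonneg fun _ _ => sq_nonneg _)

/-- The fast moments of a configuration, summed over the particles, against its exponential moment. -/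
theorem sum_fastPow_le {lam V : ℝ} (hlam : 0 < lam) (hV : 0 < V) (p : ℕ) (y : Cfg N) :
    ∑ k, fastPow p V (y k).2 ≤ ((N + 1 : ℕ) : ℝ) * ((p.factorial / (lam * V) ^ p) * expMoment lam N y) := by
  have hN : (0 : ℝ) < ((N + 1 : ℕ) : ℝ) := by positivity
  have h := avg_fastPow_le hlam hV p y
  rw [← div_le_iff₀' hN] 
  rwa [div_eq_inv_mul]

end Torus

/-- Registered anchor of this helper file (`PastSq ≥ 0`, `pastSq_nonneg`). -/
theorem pastDamping_torus_anchor : ∀ (σ : ℝ) (N : ℕ) (Φ : Flow σ N) (φ : ℕ → T3 → ℝ) (s : ℝ) (z : Cfg N) (x : T3), 0 ≤ PastSq σ N Φ φ s z x :=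
  fun _ _ Φ φ s z x => pastSq_nonneg Φ φ s z x

end

end PastDamping
end Summit.AtomisticToContinuum.HydrodynamicLimit.Theorems.ContactSourceDuhamel.TimeLocal
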